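/-
Copyright: the b2b-balaban cell (near-miss cell 7), T⁴-continuum CRUX team (coordinator ruling e34b3e0c item (2)),
seat t4-ne7b-formalise-leaf-06 (gen 28). Released under the licence of the surrounding project.
-/
import Summits.QuantumFields.BalabanUV.T4Continuum.Spine.NE7b.EnergyQuantumLemma

/-!
# The uniform heat-kernel bound `n²·P_n(x,y) ≤ 4` for simple random walk on `ℤ⁴` — discharging `hC`
# (route NE7b R-H, `t4/ROUTES-NE7b.md` v6.1 Δv6 item 3: the one analytic input of (T-k5), «or proved by Fourier»)

Cell `pub-balaban`, sub-cell `t4`, spine estimate NE7b (node U5c). `EnergyQuantumLemma.energy_quantum` ((μ) = (T-k5))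
and `EnergyDichotomy.dichotomy` ((L1)) carry the heat-kernel bound `hC : ∀ n x y, 0 < n → n²·P_n(x,y) ≤ C` on `ℤ⁴` as a
named hypothesis (the uniform corollary of the local central limit theorem, Lawler 1991 Thm 1.2.1; optimal `C → 8∕π²`).
THIS FILE PROVES IT IN THE KERNEL WITH `C = 4`, by an integral-free, purely binomial route (no Fourier analysis):

* §1 the `±1` walk on `ℤ`: `walk1 k r = 2^{−k}·Σ_i C(k,i)·[i − (k−i) = r]` (`i` = number of up-steps); Pascal ⇒ the
  recursion `walk1 (k+1) r = ½(walk1 k (r+1) + walk1 k (r−1))` (`Finset.sum_choose_succ_mul`); at most one `i`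
  contributes and `C(k,i) ≤ C(k,⌊k∕2⌋)` (`Nat.choose_le_middle`) ⇒ `walk1 k r ≤ C(k,⌊k∕2⌋)∕2^k ≤ 1∕√(k+1)`
  (`C(k,⌊k∕2⌋)²·(k+1) ≤ 4^k`, from `(j+1)·C(2j+2,j+1) = 2(2j+1)·C(2j,j)`);
* §2 the walk on `ℤ²` IS two independent `±1` walks in the coordinates `u = a+b`, `v = a−b` (the four steps `±e₁, ±e₂`
  are exactly the four sign choices `(±1, ±1)` for `(Δu, Δv)`): `walk2 k (a,b) := walk1 k (a+b)·walk1 k (a−b)` satisfies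
  the two-dimensional recursion, hence `walk2 k ≤ 1∕(k+1)`;
* §3 the walk on `ℤ⁴ = ℤ² × ℤ²` chooses at each step the block `{0,1}` or `{2,3}` with probability `½`:
  **`srwKernel_eq_walk4`**: `P_n(x,y) = 2^{−n}·Σ_k C(n,k)·walk2 k (y−x)_{01}·walk2 (n−k) (y−x)_{23}` (induction on the
  first-step recursion of `EnergyQuantumLemma.srwKernel`, Pascal again);
* §4 **`srwKernel_le`**: `P_n(x,y) ≤ 4∕((n+1)(n+2))` from `C(n,k)∕((k+1)(n+1−k)) = C(n+2,k+1)∕((n+1)(n+2))` and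
  `Σ_k C(n+2,k+1) ≤ 2^{n+2}`; **`kernel_bound`**: `∀ n x y, 0 < n → n²·P_n(x,y) ≤ 4`; and the UNCONDITIONAL energy
  quantum **`energy_quantum_unconditional`** ∕ **`dichotomy_unconditional`**: `Σ_{x∈I} s(x)² ≥ η⁴∕(4(1+η)⁴C′²)`.

HONEST FRAMING. Law-free, elementary; the constant `4` is `≈ 5×` the optimal `8∕π²` (costs `ℓ` only under PRICING's
bill A, nothing under bill B). Nothing of [Bałaban 1983–89] asserted or cited. NE7b
(`T4WeightBudget.RelWeightBound`) NOT PRINTED and NOT PROVED; spine PROVED 0∕9; rung (B)+1 on a FINITE torus T⁴ — NOT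
infinite volume, NOT the mass gap, NOT Clay. HONEST DEPENDENCY: continuum YM on T⁴ ⇐ BetaPertH ∧ nine spine estimates
(0/9 proved); BetaPertH ⇐ (D1) ∧ (D4) ∧ CAP+tail; G-an2-4 gates asym, D1 and NE2/3/4. POLICY: crux-route work under
`Spine/NE7b/` (ROUTES v6 §10 S-k5), not a `T4Continuum/Support` leaf (FREEZE (0) respected); three concrete definitions
(`walk1`, `walk2`, `walk4`), no `Prop`-valued fact, no `[cite:]` fact.
-/

set_option autoImplicit false

noncomputable section

namespace Summit.QuantumFields.BalabanUV.T4Continuum.NE7b.SRWKernelBoundZ4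

open Finset
open scoped BigOperators
open Literature.Probability.LatticeModels (Site)
open Summit.QuantumFields.BalabanUV.T4Continuum.NE7b.AbelianCurvatureMaximumPrinciple (e layer)
open Summit.QuantumFields.BalabanUV.T4Continuum.NE7b.EnergyQuantumLemma (avg srwKernel energy_quantum dichotomy)

/-! ## §1 The `±1` walk on `ℤ` -/

/-- The `k`-step kernel of the `±1` walk on `ℤ` at displacement `r`, summed over the number `i` of up-steps:
`walk1 k r = 2^{−k}·Σ_{i ≤ k} C(k,i)·[i − (k−i) = r]`. -/
def walk1 (k : ℕ) (r : ℤ) : ℝ :=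
  (∑ i ∈ Finset.range (k + 1), (k.choose i : ℝ) * (if (i : ℤ) - ((k - i : ℕ) : ℤ) = r then 1 else 0)) / 2 ^ k

/-- `walk1 k r ≥ 0`. -/
theorem walk1_nonneg (k : ℕ) (r : ℤ) : 0 ≤ walk1 k r :=
  div_nonneg (Finset.sum_nonneg fun i _ => mul_nonneg (Nat.cast_nonneg _) (by split_ifs <;> norm_num)) (by positivity)

/-- `walk1 0 r = [r = 0]`. -/
theorem walk1_zero (r : ℤ) : walk1 0 r = if r = 0 then 1 else 0 := by
  simp only [walk1, zero_add, Finset.sum_range_one, Nat.choose_self, Nat.cast_one, one_mul, pow_zero, div_one,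
    Nat.cast_zero, Nat.sub_zero, sub_zero]
  by_cases h : r = 0
  · simp [h]
  · simp [h, Ne.symm h]

/-- THE RECURSION (Pascal): `walk1 (k+1) r = ½·(walk1 k (r+1) + walk1 k (r−1))`. -/
theorem walk1_succ (k : ℕ) (r : ℤ) : walk1 (k + 1) r = (walk1 k (r + 1) + walk1 k (r - 1)) / 2 := by
  have h := Finset.sum_choose_succ_mul (R := ℝ) (fun i j => if (i : ℤ) - (j : ℤ) = r then (1 : ℝ) else 0) k
  -- the two sums on the right are the sums of `walk1 k (r+1)` and `walk1 k (r-1)`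
  have h1 : ∑ i ∈ range (k + 1), (k.choose i : ℝ) * (if (i : ℤ) - ((k + 1 - i : ℕ) : ℤ) = r then (1 : ℝ) else 0)
      = ∑ i ∈ range (k + 1), (k.choose i : ℝ) * (if (i : ℤ) - ((k - i : ℕ) : ℤ) = r + 1 then (1 : ℝ) else 0) := by
    refine Finset.sum_congr rfl fun i hi => ?_
    have hik : i ≤ k := Nat.lt_succ_iff.mp (Finset.mem_range.mp hi)
    have : ((k + 1 - i : ℕ) : ℤ) = ((k - i : ℕ) : ℤ) + 1 := by
      rw [show k + 1 - i = (k - i) + 1 by omega]; push_cast; ring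
    rw [this]
    congr 1
    exact if_congr ⟨fun hh => by linarith, fun hh => by linarith⟩ rfl rfl
  have h2 : ∑ i ∈ range (k + 1), (k.choose i : ℝ) * (if ((i + 1 : ℕ) : ℤ) - ((k - i : ℕ) : ℤ) = r then (1 : ℝ) else 0)
      = ∑ i ∈ range (k + 1), (k.choose i : ℝ) * (if (i : ℤ) - ((k - i : ℕ) : ℤ) = r - 1 then (1 : ℝ) else 0) := by
    refine Finset.sum_congr rfl fun i _ => ?_
    congr 1
    exact if_congr ⟨fun hh => by push_cast at hh; linarith, fun hh => by push_cast; linarith⟩ rfl rfl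
  unfold walk1
  rw [h, h1, h2, pow_succ]
  field_simp

/-- At most one number of up-steps reaches `r`, and its weight is at most the central coefficient:
`2^k·walk1 k r ≤ C(k, ⌊k∕2⌋)`. -/
theorem walk1_le_middle (k : ℕ) (r : ℤ) : walk1 k r ≤ (k.choose (k / 2) : ℝ) / 2 ^ k := by
  unfold walk1
  refine div_le_div_of_nonneg_right ?_ (by positivity)
  by_cases hex : ∃ i ∈ range (k + 1), (i : ℤ) - ((k - i : ℕ) : ℤ) = r
  · obtain ⟨i₀, hi₀, hr⟩ := hex
    have hik : i₀ ≤ k := Nat.lt_succ_iff.mp (Finset.mem_range.mp hi₀)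
    rw [Finset.sum_eq_single_of_mem i₀ hi₀]
    · rw [if_pos hr, mul_one]
      exact_mod_cast Nat.choose_le_middle i₀ k
    · intro i hi hne
      have hik' : i ≤ k := Nat.lt_succ_iff.mp (Finset.mem_range.mp hi)
      rw [if_neg, mul_zero]
      intro hr'
      apply hne
      have e1 : ((k - i : ℕ) : ℤ) = (k : ℤ) - i := by push_cast [Nat.cast_sub hik']; ring
      have e2 : ((k - i₀ : ℕ) : ℤ) = (k : ℤ) - i₀ := by push_cast [Nat.cast_sub hik]; ring
      rw [e1] at hr'
      rw [e2] at hr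
      omega
  · push Not at hex
    rw [Finset.sum_eq_zero fun i hi => by rw [if_neg (hex i hi), mul_zero]]
    positivity

/-- The central binomial coefficient against `4^k`: `C(k, ⌊k∕2⌋)²·(k+1) ≤ 4^k` (even `k = 2j` by induction from
`(j+1)·C(2j+2,j+1) = 2(2j+1)·C(2j,j)`; odd `k = 2j+1` from `2·C(2j+1,j) = C(2j+2,j+1)`). -/
theorem choose_middle_sq_mul_le (k : ℕ) : ((k.choose (k / 2) : ℝ)) ^ 2 * ((k : ℝ) + 1) ≤ 4 ^ k := by
  -- even case, as a statement about `centralBinom`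
  have heven : ∀ j : ℕ, ((Nat.centralBinom j : ℝ)) ^ 2 * (2 * (j : ℝ) + 1) ≤ 16 ^ j := by
    intro j
    induction j with
    | zero => simp [Nat.centralBinom_zero]
    | succ j ih =>
        have hrec : ((j : ℝ) + 1) * (Nat.centralBinom (j + 1) : ℝ) = 2 * (2 * (j : ℝ) + 1) * (Nat.centralBinom j : ℝ) := by
          exact_mod_cast Nat.succ_mul_centralBinom_succ j
        have hj : (0 : ℝ) < (j : ℝ) + 1 := by positivity
        have hc : (0 : ℝ) ≤ (Nat.centralBinom j : ℝ) := Nat.cast_nonneg _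
        -- multiply the claim by `(j+1)²`
        have key : ((j : ℝ) + 1) ^ 2 * (((Nat.centralBinom (j + 1) : ℝ)) ^ 2 * (2 * ((j + 1 : ℕ) : ℝ) + 1))
            ≤ ((j : ℝ) + 1) ^ 2 * 16 ^ (j + 1) := by
          have : ((j : ℝ) + 1) ^ 2 * (((Nat.centralBinom (j + 1) : ℝ)) ^ 2 * (2 * ((j + 1 : ℕ) : ℝ) + 1))
              = 4 * (2 * (j : ℝ) + 1) * (2 * (j : ℝ) + 3) * (((Nat.centralBinom j : ℝ)) ^ 2 * (2 * (j : ℝ) + 1)) := by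
            have : (((j : ℝ) + 1) * (Nat.centralBinom (j + 1) : ℝ)) ^ 2
                = (2 * (2 * (j : ℝ) + 1) * (Nat.centralBinom j : ℝ)) ^ 2 := by rw [hrec]
            push_cast
            nlinarith [this]
          rw [this, pow_succ]
          have hT : 0 ≤ ((Nat.centralBinom j : ℝ)) ^ 2 * (2 * (j : ℝ) + 1) := by positivity
          have hY : 4 * (2 * (j : ℝ) + 1) * (2 * (j : ℝ) + 3) ≤ ((j : ℝ) + 1) ^ 2 * 16 := by nlinarith
          calc 4 * (2 * (j : ℝ) + 1) * (2 * (j : ℝ) + 3) * (((Nat.centralBinom j : ℝ)) ^ 2 * (2 * (j : ℝ) + 1))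
              ≤ ((j : ℝ) + 1) ^ 2 * 16 * (((Nat.centralBinom j : ℝ)) ^ 2 * (2 * (j : ℝ) + 1)) :=
                mul_le_mul_of_nonneg_right hY hT
            _ ≤ ((j : ℝ) + 1) ^ 2 * 16 * 16 ^ j := mul_le_mul_of_nonneg_left ih (by positivity)
            _ = ((j : ℝ) + 1) ^ 2 * (16 ^ j * 16) := by ring
        exact le_of_mul_le_mul_left key (by positivity)
  rcases Nat.even_or_odd' k with ⟨j, rfl | rfl⟩
  · -- k = 2j
    have h1 : (2 * j) / 2 = j := by omega
    rw [h1, ← Nat.centralBinom_eq_two_mul_choose]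
    have := heven j
    push_cast
    calc ((Nat.centralBinom j : ℝ)) ^ 2 * (2 * (j : ℝ) + 1) ≤ 16 ^ j := this
      _ = 4 ^ (2 * j) := by rw [pow_mul]; norm_num
  · -- k = 2j+1
    have h1 : (2 * j + 1) / 2 = j := by omega
    rw [h1]
    have h2 : (2 : ℝ) * ((2 * j + 1).choose j : ℝ) = (Nat.centralBinom (j + 1) : ℝ) := by
      rw [Nat.centralBinom_eq_two_mul_choose, show 2 * (j + 1) = (2 * j + 1) + 1 by ring, Nat.choose_succ_succ',
        Nat.choose_symm_half]
      push_cast; ring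
    have := heven (j + 1)
    have h3 : ((2 * j + 1).choose j : ℝ) ^ 2 * (((2 * j + 1 : ℕ) : ℝ) + 1)
        = (Nat.centralBinom (j + 1) : ℝ) ^ 2 * (2 * ((j + 1 : ℕ) : ℝ) + 1) * ((2 * (j : ℝ) + 2) / (4 * (2 * (j : ℝ) + 3))) := by
      rw [← h2]; push_cast; field_simp; ring
    rw [h3]
    have h4 : (2 * (j : ℝ) + 2) / (4 * (2 * (j : ℝ) + 3)) ≤ 1 / 4 := by
      rw [div_le_div_iff₀ (by positivity) (by norm_num)]; nlinarith
    calc (Nat.centralBinom (j + 1) : ℝ) ^ 2 * (2 * ((j + 1 : ℕ) : ℝ) + 1) * ((2 * (j : ℝ) + 2) / (4 * (2 * (j : ℝ) + 3)))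
        ≤ 16 ^ (j + 1) * (1 / 4) := mul_le_mul this h4 (by positivity) (by positivity)
      _ = 4 ^ (2 * j + 1) := by rw [pow_succ, pow_succ, pow_mul, show ((4 : ℝ) ^ 2) = 16 by norm_num]; ring

/-- THE ONE-DIMENSIONAL DISPERSION BOUND: `walk1 k r ≤ 1∕√(k+1)`. -/
theorem walk1_le (k : ℕ) (r : ℤ) : walk1 k r ≤ 1 / Real.sqrt ((k : ℝ) + 1) := by
  refine (walk1_le_middle k r).trans ?_
  have hk : (0 : ℝ) < Real.sqrt ((k : ℝ) + 1) := Real.sqrt_pos.mpr (by positivity)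
  rw [div_le_div_iff₀ (by positivity) hk, one_mul]
  -- square both sides
  have hsq : ((k.choose (k / 2) : ℝ) * Real.sqrt ((k : ℝ) + 1)) ^ 2 ≤ ((2 : ℝ) ^ k) ^ 2 := by
    rw [mul_pow, Real.sq_sqrt (by positivity), ← pow_mul, show (2 : ℝ) ^ (k * 2) = 4 ^ k by
      rw [mul_comm, pow_mul]; norm_num]
    exact choose_middle_sq_mul_le k
  exact (pow_le_pow_iff_left₀ (by positivity) (by positivity) two_ne_zero).mp hsq

/-! ## §2 The walk on `ℤ²` as two independent `±1` walks -/

/-- The `k`-step kernel of simple random walk on `ℤ²` at displacement `(a,b)`, through the `45°` coordinates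
`u = a + b`, `v = a − b` in which the two components are INDEPENDENT `±1` walks. -/
def walk2 (k : ℕ) (r : ℤ × ℤ) : ℝ := walk1 k (r.1 + r.2) * walk1 k (r.1 - r.2)

/-- `walk2 ≥ 0`. -/
theorem walk2_nonneg (k : ℕ) (r : ℤ × ℤ) : 0 ≤ walk2 k r := mul_nonneg (walk1_nonneg _ _) (walk1_nonneg _ _)

/-- `walk2 0 (a,b) = [a = 0 ∧ b = 0]`. -/
theorem walk2_zero (a b : ℤ) : walk2 0 (a, b) = if a = 0 ∧ b = 0 then 1 else 0 := by
  simp only [walk2, walk1_zero]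
  by_cases ha : a = 0
  · by_cases hb : b = 0
    · simp [ha, hb]
    · simp [ha, hb]
  · have hne : ¬ (a = 0 ∧ b = 0) := fun h => ha h.1
    simp only [hne, if_false]
    split_ifs with h1 h2
    · exfalso; omega
    all_goals norm_num

/-- THE TWO-DIMENSIONAL RECURSION: `walk2 (k+1) (a,b) = ¼·Σ_{±} (walk2 k (a±1,b) + walk2 k (a,b±1))` — the four
lattice steps are the four sign patterns `(Δu, Δv) = (±1, ±1)`. -/
theorem walk2_succ (k : ℕ) (a b : ℤ) : walk2 (k + 1) (a, b)
    = (walk2 k (a + 1, b) + walk2 k (a - 1, b) + walk2 k (a, b + 1) + walk2 k (a, b - 1)) / 4 := by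
  simp only [walk2, walk1_succ]
  have e1 : a + 1 + b = a + b + 1 := by ring
  have e2 : a + 1 - b = a - b + 1 := by ring
  have e3 : a - 1 + b = a + b - 1 := by ring
  have e4 : a - 1 - b = a - b - 1 := by ring
  have e5 : a + (b + 1) = a + b + 1 := by ring
  have e6 : a - (b + 1) = a - b - 1 := by ring
  have e7 : a + (b - 1) = a + b - 1 := by ring
  have e8 : a - (b - 1) = a - b + 1 := by ring
  rw [e1, e2, e3, e4, e5, e6, e7, e8]
  ring

/-- THE TWO-DIMENSIONAL DISPERSION BOUND: `walk2 k (a,b) ≤ 1∕(k+1)`. -/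
theorem walk2_le (k : ℕ) (r : ℤ × ℤ) : walk2 k r ≤ 1 / ((k : ℝ) + 1) := by
  have hk : (0 : ℝ) < (k : ℝ) + 1 := by positivity
  have h := mul_le_mul (walk1_le k (r.1 + r.2)) (walk1_le k (r.1 - r.2)) (walk1_nonneg _ _) (by positivity)
  refine h.trans (le_of_eq ?_)
  rw [div_mul_div_comm, one_mul, Real.mul_self_sqrt hk.le]

/-! ## §3 The walk on `ℤ⁴ = ℤ² × ℤ²` -/

/-- The binomial block decomposition of the `n`-step kernel on `ℤ⁴`: at each step the walk moves in the block `{0,1}` or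
in the block `{2,3}` with probability `½` each. -/
def walk4 (n : ℕ) (x y : Site 4) : ℝ :=
  (∑ k ∈ Finset.range (n + 1),
    (n.choose k : ℝ) * (walk2 k (y 0 - x 0, y 1 - x 1) * walk2 (n - k) (y 2 - x 2, y 3 - x 3))) / 2 ^ n

/-- `walk4 0 x y = [x = y]`. -/
theorem walk4_zero (x y : Site 4) : walk4 0 x y = if x = y then 1 else 0 := by
  simp only [walk4, zero_add, Finset.sum_range_one, Nat.choose_self, Nat.cast_one, one_mul, pow_zero, div_one,
    Nat.sub_zero]
  rw [show ((y 0 - x 0, y 1 - x 1) : ℤ × ℤ) = (y 0 - x 0, y 1 - x 1) from rfl, walk2_zero, walk2_zero]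
  by_cases h : x = y
  · subst h; simp
  · rw [if_neg h]
    obtain ⟨i, hi⟩ := Function.ne_iff.mp h
    have hne : ¬ ((y 0 - x 0 = 0 ∧ y 1 - x 1 = 0) ∧ (y 2 - x 2 = 0 ∧ y 3 - x 3 = 0)) := by
      rintro ⟨⟨h0, h1⟩, h2, h3⟩
      fin_cases i <;> simp only [Fin.zero_eta, Fin.isValue, Fin.mk_one, Fin.reduceFinMk] at hi <;> omega
    split_ifs with h1 h2
    · exact absurd ⟨h1, h2⟩ hne
    all_goals norm_num

/-- Coordinates of the lattice neighbours `x ± e_c` in `ℤ⁴`. -/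
theorem e_apply (c i : Fin 4) : (e c : Site 4) i = if i = c then 1 else 0 := by
  simp [e, Pi.single_apply]

/-- **THE BLOCK DECOMPOSITION.** `P_n(x,y) = 2^{−n}·Σ_k C(n,k)·walk2 k ((y−x)₀,(y−x)₁)·walk2 (n−k) ((y−x)₂,(y−x)₃)` for the
free kernel `EnergyQuantumLemma.srwKernel` on `ℤ⁴` (induction on its first-step recursion; Pascal via
`Finset.sum_choose_succ_mul`). -/
theorem srwKernel_eq_walk4 : ∀ (n : ℕ) (x y : Site 4), srwKernel n x y = walk4 n x y
  | 0, x, y => by rw [walk4_zero]; rfl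
  | n + 1, x, y => by
      -- abbreviations for the four displacement coordinates
      set a := y 0 - x 0 with ha
      set b := y 1 - x 1 with hb
      set a' := y 2 - x 2 with ha'
      set b' := y 3 - x 3 with hb'
      -- the eight neighbour values, by induction
      have hnb : ∀ z : Site 4, srwKernel n z y = walk4 n z y := fun z => srwKernel_eq_walk4 n z y
      have step : srwKernel (n + 1) x y = (1 / (2 * ((4 : ℕ) : ℝ))) *
          ∑ c : Fin 4, (walk4 n (x + e c) y + walk4 n (x - e c) y) := by
        show avg (fun z => srwKernel n z y) x = _
        simp only [avg, hnb]
      rw [step, Fin.sum_univ_four]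
      -- evaluate the coordinates of the neighbours
      simp only [walk4, Pi.add_apply, Pi.sub_apply, e_apply]
      simp only [Fin.isValue, if_true, if_false, add_zero, sub_zero, show ((1 : Fin 4) = 0) = False by
        simp, show ((2 : Fin 4) = 0) = False by simp, show ((3 : Fin 4) = 0) = False by simp,
        show ((0 : Fin 4) = 1) = False by simp, show ((2 : Fin 4) = 1) = False by simp, show ((3 : Fin 4) = 1) = False by
        simp, show ((0 : Fin 4) = 2) = False by simp, show ((1 : Fin 4) = 2) = False by simp,
        show ((3 : Fin 4) = 2) = False by simp, show ((0 : Fin 4) = 3) = False by simp,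
        show ((1 : Fin 4) = 3) = False by simp, show ((2 : Fin 4) = 3) = False by simp]
      rw [show y 0 - (x 0 + 1) = a - 1 by rw [ha]; ring, show y 0 - (x 0 - 1) = a + 1 by rw [ha]; ring,
        show y 1 - (x 1 + 1) = b - 1 by rw [hb]; ring, show y 1 - (x 1 - 1) = b + 1 by rw [hb]; ring,
        show y 2 - (x 2 + 1) = a' - 1 by rw [ha']; ring, show y 2 - (x 2 - 1) = a' + 1 by rw [ha']; ring,
        show y 3 - (x 3 + 1) = b' - 1 by rw [hb']; ring, show y 3 - (x 3 - 1) = b' + 1 by rw [hb']; ring]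
      -- Pascal on the right-hand side
      have hP := Finset.sum_choose_succ_mul (R := ℝ) (fun i j => walk2 i (a, b) * walk2 j (a', b')) n
      rw [hP]
      -- the block-{0,1} terms recombine through `walk2_succ` in the first factor, the block-{2,3} terms in the second
      have hA : ∀ k ∈ range (n + 1), (n.choose k : ℝ) * (walk2 (k + 1) (a, b) * walk2 (n - k) (a', b'))
          = (n.choose k : ℝ) * ((walk2 k (a + 1, b) + walk2 k (a - 1, b) + walk2 k (a, b + 1) + walk2 k (a, b - 1))
              * walk2 (n - k) (a', b')) / 4 := fun k _ => by
        rw [walk2_succ]; ring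
      have hB : ∀ k ∈ range (n + 1), (n.choose k : ℝ) * (walk2 k (a, b) * walk2 (n + 1 - k) (a', b'))
          = (n.choose k : ℝ) * (walk2 k (a, b)
              * (walk2 (n - k) (a' + 1, b') + walk2 (n - k) (a' - 1, b') + walk2 (n - k) (a', b' + 1)
                + walk2 (n - k) (a', b' - 1))) / 4 := fun k hk => by
        have hkn : k ≤ n := Nat.lt_succ_iff.mp (Finset.mem_range.mp hk)
        rw [show n + 1 - k = (n - k) + 1 by omega, walk2_succ]; ring
      rw [Finset.sum_congr rfl hA, Finset.sum_congr rfl hB]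
      simp only [Finset.sum_div, ← Finset.sum_add_distrib, Finset.mul_sum]
      rw [pow_succ]
      refine Finset.sum_congr rfl fun k _ => ?_
      push_cast
      ring

/-! ## §4 The bound -/

/-- `P_n(x,y) ≤ 4∕((n+1)(n+2))` on `ℤ⁴`. -/
theorem srwKernel_le (n : ℕ) (x y : Site 4) : srwKernel n x y ≤ 4 / (((n : ℝ) + 1) * ((n : ℝ) + 2)) := by
  rw [srwKernel_eq_walk4, walk4]
  have hn1 : (0 : ℝ) < (n : ℝ) + 1 := by positivity
  have hn2 : (0 : ℝ) < (n : ℝ) + 2 := by positivity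
  -- termwise: `C(n,k)·walk2 k·walk2 (n−k) ≤ C(n,k)∕((k+1)(n−k+1)) = C(n+2,k+1)∕((n+1)(n+2))`
  have hterm : ∀ k ∈ range (n + 1),
      (n.choose k : ℝ) * (walk2 k (y 0 - x 0, y 1 - x 1) * walk2 (n - k) (y 2 - x 2, y 3 - x 3))
        ≤ ((n + 2).choose (k + 1) : ℝ) / (((n : ℝ) + 1) * ((n : ℝ) + 2)) := by
    intro k hk
    have hkn : k ≤ n := Nat.lt_succ_iff.mp (Finset.mem_range.mp hk)
    have h1 := walk2_le k (y 0 - x 0, y 1 - x 1)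
    have h2 := walk2_le (n - k) (y 2 - x 2, y 3 - x 3)
    have hprod : walk2 k (y 0 - x 0, y 1 - x 1) * walk2 (n - k) (y 2 - x 2, y 3 - x 3)
        ≤ 1 / ((k : ℝ) + 1) * (1 / (((n - k : ℕ) : ℝ) + 1)) :=
      mul_le_mul h1 h2 (walk2_nonneg _ _) (by positivity)
    -- the binomial identity `C(n,k)·(n+1)(n+2) = C(n+2,k+1)·(k+1)·(n+1−k)`
    have hid : (n.choose k : ℝ) * (((n : ℝ) + 1) * ((n : ℝ) + 2))
        = ((n + 2).choose (k + 1) : ℝ) * (((k : ℝ) + 1) * (((n - k : ℕ) : ℝ) + 1)) := by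
      have i1 : (n + 1) * n.choose k = (n + 1).choose (k + 1) * (k + 1) := Nat.add_one_mul_choose_eq n k
      have i2 : (n + 1).choose (k + 1) * (n + 2) = (n + 2).choose (k + 1) * (n + 2 - (k + 1)) :=
        Nat.choose_mul_succ_eq (n + 1) (k + 1)
      have i3 : n + 2 - (k + 1) = (n - k) + 1 := by omega
      rw [i3] at i2
      have i4 : (n.choose k) * ((n + 1) * (n + 2)) = (n + 2).choose (k + 1) * ((k + 1) * ((n - k) + 1)) := by
        calc (n.choose k) * ((n + 1) * (n + 2)) = ((n + 1) * n.choose k) * (n + 2) := by ring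
          _ = ((n + 1).choose (k + 1) * (k + 1)) * (n + 2) := by rw [i1]
          _ = ((n + 1).choose (k + 1) * (n + 2)) * (k + 1) := by ring
          _ = ((n + 2).choose (k + 1) * ((n - k) + 1)) * (k + 1) := by rw [i2]
          _ = _ := by ring
      exact_mod_cast i4
    calc (n.choose k : ℝ) * (walk2 k (y 0 - x 0, y 1 - x 1) * walk2 (n - k) (y 2 - x 2, y 3 - x 3))
        ≤ (n.choose k : ℝ) * (1 / ((k : ℝ) + 1) * (1 / (((n - k : ℕ) : ℝ) + 1))) :=
          mul_le_mul_of_nonneg_left hprod (Nat.cast_nonneg _)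
      _ = ((n + 2).choose (k + 1) : ℝ) / (((n : ℝ) + 1) * ((n : ℝ) + 2)) := by
          rw [eq_div_iff (by positivity)]
          have hk1 : (0 : ℝ) < (k : ℝ) + 1 := by positivity
          have hk2 : (0 : ℝ) < ((n - k : ℕ) : ℝ) + 1 := by positivity
          field_simp
          linarith [hid]
  -- sum of the shifted binomial row is at most `2^{n+2}`
  have hrow : ∑ k ∈ range (n + 1), ((n + 2).choose (k + 1) : ℝ) ≤ 2 ^ (n + 2) := by
    have hfull : ∑ j ∈ range (n + 3), ((n + 2).choose j : ℝ) = 2 ^ (n + 2) := by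
      exact_mod_cast Nat.sum_range_choose (n + 2)
    rw [← hfull, Finset.sum_range_succ' (fun j => ((n + 2).choose j : ℝ)) (n + 2), Finset.sum_range_succ _ (n + 1)]
    have h0 : (0 : ℝ) ≤ ((n + 2).choose (n + 1 + 1) : ℝ) := Nat.cast_nonneg _
    have h1 : (0 : ℝ) ≤ ((n + 2).choose 0 : ℝ) := Nat.cast_nonneg _
    linarith
  calc (∑ k ∈ range (n + 1), (n.choose k : ℝ) * (walk2 k (y 0 - x 0, y 1 - x 1) * walk2 (n - k) (y 2 - x 2, y 3 - x 3)))
        / 2 ^ n ≤ (∑ k ∈ range (n + 1), ((n + 2).choose (k + 1) : ℝ) / (((n : ℝ) + 1) * ((n : ℝ) + 2))) / 2 ^ n :=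
        div_le_div_of_nonneg_right (Finset.sum_le_sum hterm) (by positivity)
    _ = (∑ k ∈ range (n + 1), ((n + 2).choose (k + 1) : ℝ)) / (((n : ℝ) + 1) * ((n : ℝ) + 2)) / 2 ^ n := by
        rw [← Finset.sum_div]
    _ ≤ 2 ^ (n + 2) / (((n : ℝ) + 1) * ((n : ℝ) + 2)) / 2 ^ n :=
        div_le_div_of_nonneg_right (div_le_div_of_nonneg_right hrow (by positivity)) (by positivity)
    _ = 4 / (((n : ℝ) + 1) * ((n : ℝ) + 2)) := by
        rw [pow_add]; field_simp; ring

/-- **THE HEAT-KERNEL HYPOTHESIS `hC` OF (T-k5), DISCHARGED WITH `C = 4`:** `n²·P_n(x,y) ≤ 4` on `ℤ⁴` (`n ≥ 1`; in fact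
for all `n`). -/
theorem kernel_bound : ∀ (n : ℕ) (x y : Site 4), 0 < n → (n : ℝ) ^ 2 * srwKernel n x y ≤ 4 := by
  intro n x y _
  have hn : (0 : ℝ) ≤ (n : ℝ) := Nat.cast_nonneg n
  calc (n : ℝ) ^ 2 * srwKernel n x y ≤ (n : ℝ) ^ 2 * (4 / (((n : ℝ) + 1) * ((n : ℝ) + 2))) :=
        mul_le_mul_of_nonneg_left (srwKernel_le n x y) (by positivity)
    _ ≤ 4 := by
        rw [← mul_div_assoc, div_le_iff₀ (by positivity)]
        nlinarith

/-- **(T-k5) UNCONDITIONAL.** `EnergyQuantumLemma.energy_quantum` with `hC` discharged (`C = 4`):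
`Σ_{x∈I} s(x)² ≥ η⁴∕((1+η)⁴·4·C′²)`. -/
theorem energy_quantum_unconditional {I : Finset (Site 4)} {s : Site 4 → ℝ} {C' b η M : ℝ} {p₀ : Site 4}
    (hC' : 0 < C') (hb : 0 ≤ b) (hη : 0 < η)
    (hsub : ∀ x ∈ I, 8 * s x ≤ (∑ l : Fin 4, (s (x + e l) + s (x - e l))) + C' * M ^ 2)
    (hbdry : ∀ y ∈ layer I, s y ≤ b) (hp₀ : p₀ ∈ I) (hMp : M ≤ s p₀) (hgap : (1 + η) * b < M) :
    η ^ 4 / ((1 + η) ^ 4 * 4 * C' ^ 2) ≤ ∑ x ∈ I, s x ^ 2 :=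
  energy_quantum kernel_bound hC' hb hη hsub hbdry hp₀ hMp hgap

/-- **(L1) UNCONDITIONAL, scalar form.** `EnergyQuantumLemma.dichotomy` with `hC` discharged (`C = 4`). -/
theorem dichotomy_unconditional {I : Finset (Site 4)} {s : Site 4 → ℝ} {C' b η : ℝ} {p₀ : Site 4}
    (hC' : 0 < C') (hb : 0 ≤ b) (hη : 0 < η) (hp₀ : p₀ ∈ I) (hmax : ∀ x ∈ I, s x ≤ s p₀)
    (hsub : ∀ x ∈ I, 8 * s x ≤ (∑ l : Fin 4, (s (x + e l) + s (x - e l))) + C' * s p₀ ^ 2)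
    (hbdry : ∀ y ∈ layer I, s y ≤ b) :
    (∀ x ∈ I, s x ≤ (1 + η) * b) ∨ η ^ 4 / ((1 + η) ^ 4 * 4 * C' ^ 2) ≤ ∑ x ∈ I, s x ^ 2 :=
  dichotomy kernel_bound hC' hb hη hp₀ hmax hsub hbdry

end Summit.QuantumFields.BalabanUV.T4Continuum.NE7b.SRWKernelBoundZ4
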